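import Summits.Ventures.PercRepro.C026TwoCluster

/-!
# The K-cut map: the cut case of the cluster-cube certificate is a theorem (mine-3 §45; gen 51)

For a configuration `S` (`true` = red) on a multigraph with marked vertices `c`, `one` (the
terminal `1`) and `t` (the terminal `2`): `redReach S one c` = the RED CLUSTER `K(S)` of `c`
(reached from `c` by a red walk avoiding `one`); `tSide S one c t` = the `t`-SIDE `D°(S)` of the
blue cluster of `t` (reached from `t` by a blue walk avoiding `K(S)`); `kcutEdges S one c t` =
the blue edges joining `K(S)` to `D°(S)`; `kcut S one c t = S ⊔ kcutEdges S one c t` = the K-CUT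
MAP («redden exactly the blue edges that join the red cluster of `c` to the `t`-side»).
For `S` with «`c` does not reach `t` avoiding `one`» (`Good₁ S = 0` in the cut case `D₁ = {1}`)
and `one ∉ cluster Sᶜ t`: `kcutEdges_mem_cluster` (the image lies in the cluster cube of `S`),
`cluster_kcut` (the image's blue cluster of `t` IS `D°(S)`), `walkAvoiding_kcut` (if `c ~_S one`
the image has `Good₂ = 1`), `kcut_injective` (the decoder: the image shows `D°(S)`; off its
boundary nothing changed; a red walk from `c` never touches the boundary, so the red cluster is
the same for two preimages; a boundary edge of the image is a K-cut edge iff its outer end is in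
the red cluster), and `card_notReach_le_card_good`: on every finite family closed under the map
`#{Good₁ = 0} ≤ #{Good₂ = 1}`, i.e. `#Bad ≤ #GG` — conjecture (CUT-INJ) of MINE3-GLUING §43 (d) /
§44, the cut case of the certificate (CC) with room.
-/

namespace PercRepro

namespace MultiGraph

open Finset

variable {V E : Type*} (G : MultiGraph V E)

omit G in
/-- A complemented configuration opens exactly the closed edges. -/
theorem compl_apply_eq_true_iff (ω : Config E) (e : E) : ωᶜ e = true ↔ ω e = false := by
  rw [Pi.compl_apply]
  cases ω e <;> decide

omit G in
/-- A join of configurations opens the edges open in either. -/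
theorem configSup_eq_true_iff (ω τ : Config E) (e : E) :
    (ω ⊔ τ) e = true ↔ (ω e = true ∨ τ e = true) := by
  rw [Pi.sup_apply]
  cases ω e <;> cases τ e <;> decide

omit G in
/-- Joining a configuration closed at `e` does not change the value at `e`. -/
theorem sup_apply_of_eq_false {ω τ : Config E} {e : E} (h : τ e = false) : (ω ⊔ τ) e = ω e := by
  rw [Pi.sup_apply, h]
  cases ω e <;> decide

variable {G}

/-- The end of an avoiding walk lies outside the avoided set. -/
theorem WalkAvoiding.end_not_mem {ω : Config E} {W : Set V} {u v : V}
    (h : G.WalkAvoiding ω W u v) : v ∉ W := by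
  rcases h with ⟨hu, hw⟩
  induction hw with
  | refl => exact hu
  | tail _ hbc _ => exact hbc.2

/-- Appending an open edge to a vertex outside `W` at the end of an avoiding walk. -/
theorem WalkAvoiding.tail_of_not_mem {ω : Config E} {W : Set V} {u v w : V} (h : G.WalkAvoiding ω W u v)
    (hvw : G.OpenAdj ω v w) (hw : w ∉ W) : G.WalkAvoiding ω W u w :=
  ⟨h.1, h.2.tail ⟨hvw, hw⟩⟩

/-- The trivial avoiding walk. -/
theorem WalkAvoiding.refl {ω : Config E} {W : Set V} {u : V} (hu : u ∉ W) :
    G.WalkAvoiding ω W u u :=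
  ⟨hu, Relation.ReflTransGen.refl⟩

variable (G)

/-- The red cluster `K(S)` of `c` avoiding `one`: the vertices reached from `c` by an `S`-open
walk none of whose vertices is `one`. -/
def redReach (S : Config E) (one c : V) : Set V := {v | G.WalkAvoiding S {one} c v}

/-- The `t`-side `D°(S)` of the blue cluster of `t`: the vertices reached from `t` by an
`Sᶜ`-open (blue) walk none of whose vertices lies in the red cluster `K(S)`. -/
def tSide (S : Config E) (one c t : V) : Set V :=
  {v | G.WalkAvoiding Sᶜ (G.redReach S one c) t v}

open Classical in
/-- The K-cut edges: the `S`-blue edges with one end in the red cluster `K(S)` and the other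
end in the `t`-side `D°(S)`. -/
noncomputable def kcutEdges (S : Config E) (one c t : V) : Config E := fun e =>
  decide (S e = false ∧
    ((G.fst e ∈ G.redReach S one c ∧ G.snd e ∈ G.tSide S one c t) ∨
      (G.snd e ∈ G.redReach S one c ∧ G.fst e ∈ G.tSide S one c t)))

/-- The K-cut map: redden exactly the K-cut edges. -/
noncomputable def kcut (S : Config E) (one c t : V) : Config E := S ⊔ G.kcutEdges S one c t

variable {G}

/-- Membership in the red cluster: an `S`-open walk from `c` avoiding `one`. -/
theorem mem_redReach {S : Config E} {one c v : V} :
    v ∈ G.redReach S one c ↔ G.WalkAvoiding S {one} c v := Iff.rfl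

/-- Membership in the `t`-side: a blue walk from `t` avoiding the red cluster. -/
theorem mem_tSide {S : Config E} {one c t v : V} :
    v ∈ G.tSide S one c t ↔ G.WalkAvoiding Sᶜ (G.redReach S one c) t v := Iff.rfl

open Classical in
/-- The defining property of a K-cut edge. -/
theorem kcutEdges_eq_true_iff {S : Config E} {one c t : V} {e : E} :
    G.kcutEdges S one c t e = true ↔ (S e = false ∧
      ((G.fst e ∈ G.redReach S one c ∧ G.snd e ∈ G.tSide S one c t) ∨
        (G.snd e ∈ G.redReach S one c ∧ G.fst e ∈ G.tSide S one c t))) := by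
  unfold kcutEdges
  exact decide_eq_true_iff

/-- The K-cut map only opens edges. -/
theorem le_kcut (S : Config E) (one c t : V) : S ≤ G.kcut S one c t := le_sup_left

/-- `c` itself lies in its red cluster. -/
theorem self_mem_redReach {S : Config E} {one c : V} (hc : c ≠ one) : c ∈ G.redReach S one c :=
  WalkAvoiding.refl (by simpa using hc)

/-- The `t`-side is disjoint from the red cluster. -/
theorem not_mem_redReach_of_mem_tSide {S : Config E} {one c t v : V}
    (hv : v ∈ G.tSide S one c t) : v ∉ G.redReach S one c :=
  WalkAvoiding.end_not_mem hv

/-- The `t`-side lies inside the blue cluster of `t`. -/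
theorem tSide_subset_cluster (S : Config E) (one c t : V) :
    G.tSide S one c t ⊆ G.cluster Sᶜ t := by
  intro v hv
  exact (G.mem_cluster).2 (WalkAvoiding.conn hv)

/-- **(L1)** Every K-cut edge is a blue edge of `S` with both ends in the blue cluster of `t`:
`kcut S` lies in the cluster cube of `S`. -/
theorem kcutEdges_mem_cluster {S : Config E} {one c t : V} {e : E}
    (he : G.kcutEdges S one c t e = true) :
    S e = false ∧ G.fst e ∈ G.cluster Sᶜ t ∧ G.snd e ∈ G.cluster Sᶜ t := by
  rw [kcutEdges_eq_true_iff] at he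
  obtain ⟨hSe, h⟩ := he
  have hadj : G.OpenAdj Sᶜ (G.fst e) (G.snd e) :=
    G.openAdj_of_open e ((compl_apply_eq_true_iff S e).2 hSe)
  rcases h with ⟨_, hsnd⟩ | ⟨_, hfst⟩
  · have h2 := tSide_subset_cluster S one c t hsnd
    refine ⟨hSe, ?_, h2⟩
    exact (G.mem_cluster).2 (((G.mem_cluster).1 h2).tail hadj.symm)
  · have h1 := tSide_subset_cluster S one c t hfst
    refine ⟨hSe, h1, ?_⟩
    exact (G.mem_cluster).2 (((G.mem_cluster).1 h1).tail hadj)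

/-- **(L2)** The blue cluster of `t` in `kcut S` is exactly the `t`-side of `S`
(hypothesis: `c` does not reach `t` avoiding `one`). -/
theorem cluster_kcut {S : Config E} {one c t : V} (ht : t ∉ G.redReach S one c) :
    G.cluster (G.kcut S one c t)ᶜ t = G.tSide S one c t := by
  ext v
  rw [mem_cluster, mem_tSide]
  constructor
  · intro h
    refine Conn.induction (G := G) (ω := (G.kcut S one c t)ᶜ) (u := t)
      (motive := fun w => G.WalkAvoiding Sᶜ (G.redReach S one c) t w) (WalkAvoiding.refl ht) ?_ h
    intro p q _ hpq ih
    obtain ⟨e, he, hend⟩ := hpq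
    rw [compl_apply_eq_true_iff] at he
    -- `e` is closed in `kcut S`: closed in `S` and not a K-cut edge
    have hS : S e = false := by
      cases hS : S e
      · rfl
      · exfalso
        have : (G.kcut S one c t) e = true := (configSup_eq_true_iff _ _ e).2 (Or.inl hS)
        rw [he] at this
        exact absurd this (by decide)
    have hX : G.kcutEdges S one c t e = false := by
      cases hX : G.kcutEdges S one c t e
      · rfl
      · exfalso
        have : (G.kcut S one c t) e = true := (configSup_eq_true_iff _ _ e).2 (Or.inr hX)
        rw [he] at this
        exact absurd this (by decide)
    have hp : p ∈ G.tSide S one c t := ih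
    have hq : q ∉ G.redReach S one c := by
      intro hq
      have : G.kcutEdges S one c t e = true := by
        rw [kcutEdges_eq_true_iff]
        refine ⟨hS, ?_⟩
        rcases hend with ⟨h1, h2⟩ | ⟨h1, h2⟩
        · exact Or.inr ⟨h2 ▸ hq, h1 ▸ hp⟩
        · exact Or.inl ⟨h1 ▸ hq, h2 ▸ hp⟩
      rw [hX] at this
      exact absurd this (by decide)
    exact ih.tail_of_not_mem ⟨e, (compl_apply_eq_true_iff S e).2 hS, hend⟩ hq
  · intro h
    rcases h with ⟨_, hw⟩
    induction hw with
    | refl => exact Conn.refl G _ t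
    | @tail p q hp hpq ih =>
      obtain ⟨⟨e, he, hend⟩, hq⟩ := hpq
      rw [compl_apply_eq_true_iff] at he
      have hpK : p ∉ G.redReach S one c := WalkAvoiding.end_not_mem ⟨ht, hp⟩
      have hX : G.kcutEdges S one c t e = false := by
        cases hX : G.kcutEdges S one c t e
        · rfl
        · exfalso
          rw [kcutEdges_eq_true_iff] at hX
          rcases hX.2 with ⟨h1, _⟩ | ⟨h1, _⟩
          · rcases hend with ⟨h3, _⟩ | ⟨h3, _⟩
            · exact hpK (h3 ▸ h1)
            · exact hq (h3 ▸ h1)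
          · rcases hend with ⟨_, h4⟩ | ⟨_, h4⟩
            · exact hq (h4 ▸ h1)
            · exact hpK (h4 ▸ h1)
      have hT : (G.kcut S one c t)ᶜ e = true := by
        rw [compl_apply_eq_true_iff, kcut, sup_apply_of_eq_false hX, he]
      exact ih.tail ⟨e, hT, hend⟩

/-- **(L3)** If `c ~_S one`, then in `kcut S` the vertex `c` reaches `one` avoiding the blue
cluster of `t` — the image has `Good₂ = 1`. -/
theorem walkAvoiding_kcut {S : Config E} {one c t : V} (hc : c ≠ one)
    (ht : t ∉ G.redReach S one c) (hone : one ∉ G.cluster Sᶜ t) (hS : G.Conn S c one) :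
    G.WalkAvoiding (G.kcut S one c t) (G.cluster (G.kcut S one c t)ᶜ t) c one := by
  rw [cluster_kcut ht]
  have hone' : one ∉ G.tSide S one c t := fun h => hone (tSide_subset_cluster S one c t h)
  obtain ⟨w, hw, hwalk⟩ := exists_first_mem_of_conn hS (Set.mem_singleton one)
  rw [Set.mem_singleton_iff] at hw
  rw [hw] at hwalk
  -- along the walk every vertex before `one` lies in the red cluster, hence outside the `t`-side
  have key : ∀ x, Relation.ReflTransGen (fun x y => G.OpenAdj S x y ∧ x ∉ ({one} : Set V)) c x →
      (x ∈ G.redReach S one c ∨ x = one) ∧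
        Relation.ReflTransGen
          (fun x y => G.OpenAdj (G.kcut S one c t) x y ∧ y ∉ G.tSide S one c t) c x := by
    intro x hx
    induction hx with
    | refl => exact ⟨Or.inl (self_mem_redReach hc), Relation.ReflTransGen.refl⟩
    | @tail p q _ hpq ih =>
      obtain ⟨hadj, hpw⟩ := hpq
      rw [Set.mem_singleton_iff] at hpw
      have hpK : p ∈ G.redReach S one c := by
        rcases ih.1 with h | h
        · exact h
        · exact absurd h hpw
      have hqK : q ∈ G.redReach S one c ∨ q = one := by
        by_cases hqw : q = one
        · exact Or.inr hqw
        · exact Or.inl (WalkAvoiding.tail_of_not_mem hpK hadj (by simpa using hqw))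
      refine ⟨hqK, ih.2.tail ⟨hadj.mono (le_kcut S one c t), ?_⟩⟩
      rcases hqK with h | h
      · exact fun h' => not_mem_redReach_of_mem_tSide h' h
      · rw [h]
        exact hone'
  exact ⟨fun h => not_mem_redReach_of_mem_tSide h (self_mem_redReach hc), (key one hwalk).2⟩

/-- Off the boundary of the `t`-side, `kcut` changes nothing: a K-cut edge has exactly one end
in the `t`-side. -/
theorem kcutEdges_eq_false_of_not_boundary {S : Config E} {one c t : V} {e : E}
    (h : G.fst e ∈ G.tSide S one c t ↔ G.snd e ∈ G.tSide S one c t) :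
    G.kcutEdges S one c t e = false := by
  cases hX : G.kcutEdges S one c t e
  · rfl
  · exfalso
    rw [kcutEdges_eq_true_iff] at hX
    rcases hX.2 with ⟨h1, h2⟩ | ⟨h1, h2⟩
    · exact not_mem_redReach_of_mem_tSide (h.2 h2) h1
    · exact not_mem_redReach_of_mem_tSide (h.1 h2) h1

/-- Two configurations with the same K-cut image and the same `t`-side agree on every edge that
is not a boundary edge of the `t`-side. -/
theorem apply_eq_of_kcut_eq {S S' : Config E} {one c t : V}
    (heq : G.kcut S one c t = G.kcut S' one c t)
    (hD : G.tSide S one c t = G.tSide S' one c t) {e : E}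
    (h : G.fst e ∈ G.tSide S one c t ↔ G.snd e ∈ G.tSide S one c t) : S e = S' e := by
  have h1 : G.kcutEdges S one c t e = false := kcutEdges_eq_false_of_not_boundary h
  have h2 : G.kcutEdges S' one c t e = false :=
    kcutEdges_eq_false_of_not_boundary (by rw [← hD]; exact h)
  have := congrFun heq e
  rwa [kcut, kcut, sup_apply_of_eq_false h1, sup_apply_of_eq_false h2] at this

/-- The red cluster of `c` is determined by the K-cut image: a red walk from `c` never touches
the boundary of the `t`-side, so it is open in every preimage. -/
theorem redReach_subset_of_kcut_eq {S S' : Config E} {one c t : V} (hc : c ≠ one)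
    (heq : G.kcut S one c t = G.kcut S' one c t)
    (hD : G.tSide S one c t = G.tSide S' one c t) :
    G.redReach S one c ⊆ G.redReach S' one c := by
  intro x hx
  rcases hx with ⟨_, hw⟩
  have key : ∀ y, Relation.ReflTransGen (fun x y => G.OpenAdj S x y ∧ y ∉ ({one} : Set V)) c y →
      y ∈ G.redReach S one c ∧ y ∈ G.redReach S' one c := by
    intro y hy
    induction hy with
    | refl => exact ⟨self_mem_redReach hc, self_mem_redReach hc⟩
    | @tail p q hp hpq ih =>
      obtain ⟨⟨e, he, hend⟩, hq⟩ := hpq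
      have hqK : q ∈ G.redReach S one c := WalkAvoiding.tail_of_not_mem ih.1 ⟨e, he, hend⟩ hq
      -- both ends of `e` lie in the red cluster, hence outside the `t`-side: `e` is not a boundary edge
      have hnb : G.fst e ∈ G.tSide S one c t ↔ G.snd e ∈ G.tSide S one c t := by
        rcases hend with ⟨h1, h2⟩ | ⟨h1, h2⟩
        · subst h1; subst h2
          exact ⟨fun h => absurd ih.1 (not_mem_redReach_of_mem_tSide h),
            fun h => absurd hqK (not_mem_redReach_of_mem_tSide h)⟩
        · subst h1; subst h2
          exact ⟨fun h => absurd hqK (not_mem_redReach_of_mem_tSide h),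
            fun h => absurd ih.1 (not_mem_redReach_of_mem_tSide h)⟩
      have he' : S' e = true := by rw [← apply_eq_of_kcut_eq heq hD hnb]; exact he
      exact ⟨hqK, WalkAvoiding.tail_of_not_mem ih.2 ⟨e, he', hend⟩ hq⟩
  exact (key x hw).2

/-- A K-cut edge of `S` is a K-cut edge of every `S'` with the same `t`-side and red cluster. -/
theorem kcutEdges_le_of_kcut_eq {S S' : Config E} {one c t : V}
    (hone' : one ∉ G.cluster S'ᶜ t)
    (hD : G.tSide S one c t = G.tSide S' one c t)
    (hK : G.redReach S one c = G.redReach S' one c) {e : E}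
    (he : G.kcutEdges S one c t e = true) : G.kcutEdges S' one c t e = true := by
  rw [kcutEdges_eq_true_iff] at he ⊢
  obtain ⟨hSe, h⟩ := he
  -- an end in the `t`-side is not `one`
  have hnot_one : ∀ v, v ∈ G.tSide S' one c t → v ∉ ({one} : Set V) := by
    intro v hv hv1
    rw [Set.mem_singleton_iff] at hv1
    rw [hv1] at hv
    exact hone' (tSide_subset_cluster S' one c t hv)
  -- `e` is closed in `S'`: otherwise its `t`-side end would be red-reachable
  have hS'e : S' e = false := by
    cases hS' : S' e
    · rfl
    · exfalso
      rcases h with ⟨h1, h2⟩ | ⟨h1, h2⟩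
      · rw [hK] at h1; rw [hD] at h2
        have : G.snd e ∈ G.redReach S' one c :=
          WalkAvoiding.tail_of_not_mem h1 (G.openAdj_of_open e hS') (hnot_one _ h2)
        exact not_mem_redReach_of_mem_tSide h2 this
      · rw [hK] at h1; rw [hD] at h2
        have : G.fst e ∈ G.redReach S' one c :=
          WalkAvoiding.tail_of_not_mem h1 (G.openAdj_of_open e hS').symm (hnot_one _ h2)
        exact not_mem_redReach_of_mem_tSide h2 this
  refine ⟨hS'e, ?_⟩
  rw [← hK, ← hD]
  exact h

/-- **(L4) Injectivity of the K-cut map** on the configurations with `c ≠ one`,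
«`c` does not reach `t` avoiding `one`» and `one ∉ cluster Sᶜ t`. -/
theorem kcut_injective {S S' : Config E} {one c t : V} (hc : c ≠ one)
    (ht : t ∉ G.redReach S one c) (ht' : t ∉ G.redReach S' one c)
    (hone : one ∉ G.cluster Sᶜ t) (hone' : one ∉ G.cluster S'ᶜ t)
    (heq : G.kcut S one c t = G.kcut S' one c t) : S = S' := by
  -- the image shows the `t`-side
  have hD : G.tSide S one c t = G.tSide S' one c t := by
    rw [← cluster_kcut ht, ← cluster_kcut ht', heq]
  -- and determines the red cluster
  have hK : G.redReach S one c = G.redReach S' one c :=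
    Set.Subset.antisymm (redReach_subset_of_kcut_eq hc heq hD)
      (redReach_subset_of_kcut_eq hc heq.symm hD.symm)
  -- hence the K-cut edges
  have hX : G.kcutEdges S one c t = G.kcutEdges S' one c t := by
    funext e
    cases h1 : G.kcutEdges S one c t e
    · cases h2 : G.kcutEdges S' one c t e
      · rfl
      · rw [kcutEdges_le_of_kcut_eq hone hD.symm hK.symm h2] at h1
        exact absurd h1 (by decide)
    · exact (kcutEdges_le_of_kcut_eq hone' hD hK h1).symm
  -- and then the configurations themselves
  funext e
  cases h1 : G.kcutEdges S one c t e
  · have := congrFun heq e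
    rw [kcut, kcut, sup_apply_of_eq_false h1, sup_apply_of_eq_false (hX ▸ h1)] at this
    exact this
  · have h2 : G.kcutEdges S' one c t e = true := hX ▸ h1
    rw [kcutEdges_eq_true_iff] at h1 h2
    rw [h1.1, h2.1]

section Count

open Classical in
/-- **(L5) (CUT-INJ), counting form.** Let `𝒰` be a finite family of configurations, each with
`c ~ one` and `one ∉ cluster Sᶜ t`, closed under the K-cut map on its members with
«`c` does not reach `t` avoiding `one`».  Then
`#{S ∈ 𝒰 : c does not reach t avoiding one} ≤ #{S ∈ 𝒰 : c reaches one avoiding the blue cluster of t}`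
— in the cut case `D₁ = {1}`: `#{Good₁ = 0} ≤ #{Good₂ = 1}`, i.e. `#Bad ≤ #GG`, on every family
closed under reddening K-cut edges (every ≼-closed family of the cut frame qualifies). -/
theorem card_notReach_le_card_good {one c t : V} (hc : c ≠ one) (𝒰 : Finset (Config E))
    (hmem : ∀ S ∈ 𝒰, G.Conn S c one ∧ one ∉ G.cluster Sᶜ t)
    (hclosed : ∀ S ∈ 𝒰, t ∉ G.redReach S one c → G.kcut S one c t ∈ 𝒰) :
    (𝒰.filter fun S => t ∉ G.redReach S one c).card ≤
      (𝒰.filter fun S => G.WalkAvoiding S (G.cluster Sᶜ t) c one).card := by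
  refine card_le_card_of_injOn (fun S => G.kcut S one c t) ?_ ?_
  · intro S hS
    rw [coe_filter] at hS
    obtain ⟨hS𝒰, hSt⟩ := hS
    rw [coe_filter]
    refine ⟨hclosed S hS𝒰 hSt, ?_⟩
    exact walkAvoiding_kcut hc hSt (hmem S hS𝒰).2 (hmem S hS𝒰).1
  · intro S hS S' hS' heq
    rw [coe_filter] at hS hS'
    exact kcut_injective hc hS.2 hS'.2 (hmem S hS.1).2 (hmem S' hS'.1).2 heq

end Count

end MultiGraph

end PercRepro
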